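import Mathlib
import Summits.MatrixMultiplication.MatrixMultiplication.Theorems.SnSubsetDichotomyNoThresholdSubsetTriplePlancherelStepDefs

/-!
# `SnSubsetDichotomy.NoThresholdSubsetTriple`, line `klr-graded-polynomial-method`:
# stub `transProb_sum_eq_one` (the Plancherel transition probabilities of a Young diagram sum to one)

For a finite lower set `ν ⊆ ℕ × ℕ` (a Young diagram; cells `(row, col)`), the hook-product transition
probabilities `p_y = ∏_{j < col y} h(row y, j)/(h+1) · ∏_{i < row y} h(i, col y)/(h+1)`
(`PlancherelStep.transProb`) of its addable nodes `y` sum to `1` — the Greene–Nijenhuis–Wilf theorem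
("the hook walk ends at some corner", Adv. Math. 31 (1979) 104–109), i.e. the up-branching rule
`Σ_{λ = ν + □} f^λ = (|ν|+1) f^ν`; Kerov: the transition weights of a diagram form a probability measure.

Proof (Kerov's generating function, as an induction on the number of rows; no corner bookkeeping).
Write `λ_a = rowLen ν a`, `n = λ_0`, `c_j = colLen ν j`,
`R_N(ν, u) = (u - N)⁻¹ ∏_{j<N} (u - j + c_j - 1)/(u - j + c_j)` (`= ∏_{inner corners}(u - content) /
∏_{outer corners}(u - content)`, independent of `N ≥ n`: `kerovR_add`).  We prove simultaneously, by
induction on `colLen ν 0`, the identities `Σ_a p_(a, λ_a) = 1` and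
`Σ_a p_(a, λ_a) / (u - (λ_a - a)) = R_n(ν, u)` (`u > n`) (`main`), summing over ALL rows
`a ≤ colLen ν 0`: a non-addable "virtual corner" `(a, λ_a)` has `p = 0` (a zero hook in its column
product, `transProb_eq_zero_of_not_mem`), so these are the sums over `addableNodes ν`
(`sum_addableNodes_eq`).  Removing the top row (`ν'`, `(i, j) ∈ ν' ↔ (i+1, j) ∈ ν`) gives
`p^ν_(a+1, b) = h(0,b)/(h(0,b)+1) · p^{ν'}_(a, b)` (`transProb_shift`) with
`h(0, λ'_a) + 1 = n + 1 - (λ'_a - a)` at a genuine corner of `ν'` (`hook_zero_cast`), so the weight is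
`1 - 1/(n + 1 - c'_a)`; after the partial fraction `1/((n+1-c)(u+1-c)) = (1/(n+1-c) - 1/(u+1-c))/(u-n)`
both identities for `ν` follow from those for `ν'` at `u + 1` and at `n + 1`, the top corner
contributing `p_(0, n) = R_n(ν', n + 1)` (`transProb_zero`), together with
`R_n(ν, u) = R_n(ν', u+1) (u - n + 1)/(u - n)` (`kerovR_shift`).  Carrying the first identity along
replaces the limit `u → ∞` of `u R_n(ν, u)`.  References: Greene–Nijenhuis–Wilf (1979), §2; S. V. Kerov,
*Transition probabilities of continual Young diagrams and the Markov moment problem*, Funct. Anal.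
Appl. 27 (1993), §1 (`Σ_k p_k/(u - x_k) = ∏(u - y_i)/∏(u - x_k)`).
-/

open scoped BigOperators
open Literature.RepresentationTheory.FiniteGroups (addableNodes IsAddableNode)

namespace Summit.MatrixMultiplication.MatrixMultiplication.Theorems

open PlancherelStep

variable {ν ν' : Finset (ℕ × ℕ)}

set_option linter.dupNamespace false in -- deliberate Summit.<S>.<P> duplicate
/-- In a Young diagram `ν` (a finite lower set of `ℕ × ℕ`), `(i, j)` is a cell iff `j < rowLen ν i`:
row `i` is an initial segment. [folklore] -/
private theorem mem_iff_lt_rowLen (hν : IsLowerSet (ν : Set (ℕ × ℕ))) {i j : ℕ} :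
    (i, j) ∈ ν ↔ j < rowLen ν i := by
  unfold rowLen
  refine ⟨fun h => ?_, fun h => by_contra fun hmem => absurd h (not_lt.2 ?_)⟩
  · calc j < ((Finset.range (j + 1)).image (fun k => (i, k))).card := by
          rw [Finset.card_image_of_injective _ (Prod.mk_right_injective i), Finset.card_range]
          exact Nat.lt_succ_self j
      _ ≤ _ := by
          refine Finset.card_le_card fun c hc => ?_
          obtain ⟨k, hk, rfl⟩ := Finset.mem_image.1 hc
          rw [Finset.mem_range] at hk
          exact Finset.mem_filter.2 ⟨hν (Prod.mk_le_mk.2 ⟨le_rfl, Nat.lt_succ_iff.1 hk⟩) h, rfl⟩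
  · calc _ ≤ ((Finset.range j).image (fun k => (i, k))).card := by
          refine Finset.card_le_card fun c hc => ?_
          obtain ⟨hcν, hci⟩ := Finset.mem_filter.1 hc
          refine Finset.mem_image.2 ⟨c.2, Finset.mem_range.2 ?_, Prod.ext hci.symm rfl⟩
          by_contra hlt
          exact hmem (hν (Prod.le_def.2 ⟨hci.ge, not_lt.1 hlt⟩) hcν)
      _ ≤ j := Finset.card_image_le.trans (Finset.card_range j).le

set_option linter.dupNamespace false in -- deliberate Summit.<S>.<P> duplicate
/-- In a Young diagram `ν`, `(i, j)` is a cell iff `i < colLen ν j`: column `j` is an initial segment.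
[folklore] -/
private theorem mem_iff_lt_colLen (hν : IsLowerSet (ν : Set (ℕ × ℕ))) {i j : ℕ} :
    (i, j) ∈ ν ↔ i < colLen ν j := by
  unfold colLen
  refine ⟨fun h => ?_, fun h => by_contra fun hmem => absurd h (not_lt.2 ?_)⟩
  · calc i < ((Finset.range (i + 1)).image (fun k => (k, j))).card := by
          rw [Finset.card_image_of_injective _ (Prod.mk_left_injective j), Finset.card_range]
          exact Nat.lt_succ_self i
      _ ≤ _ := by
          refine Finset.card_le_card fun c hc => ?_
          obtain ⟨k, hk, rfl⟩ := Finset.mem_image.1 hc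
          rw [Finset.mem_range] at hk
          exact Finset.mem_filter.2 ⟨hν (Prod.mk_le_mk.2 ⟨Nat.lt_succ_iff.1 hk, le_rfl⟩) h, rfl⟩
  · calc _ ≤ ((Finset.range i).image (fun k => (k, j))).card := by
          refine Finset.card_le_card fun c hc => ?_
          obtain ⟨hcν, hcj⟩ := Finset.mem_filter.1 hc
          refine Finset.mem_image.2 ⟨c.1, Finset.mem_range.2 ?_, Prod.ext rfl hcj.symm⟩
          by_contra hlt
          exact hmem (hν (Prod.le_def.2 ⟨not_lt.1 hlt, hcj.ge⟩) hcν)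
      _ ≤ i := Finset.card_image_le.trans (Finset.card_range i).le

set_option linter.dupNamespace false in -- deliberate Summit.<S>.<P> duplicate
/-- Two naturals with the same strict lower bounds are equal. [folklore] -/
private theorem nat_eq_of_forall_lt_iff {m n : ℕ} (h : ∀ j, j < m ↔ j < n) : m = n := by
  rcases Nat.lt_trichotomy m n with hlt | heq | hgt
  · exact absurd ((h m).2 hlt) (lt_irrefl m)
  · exact heq
  · exact absurd ((h n).1 hgt) (lt_irrefl n)

set_option linter.dupNamespace false in -- deliberate Summit.<S>.<P> duplicate
/-- Row lengths of a Young diagram are bounded by the length of the top row. [folklore] -/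
private theorem rowLen_le (hν : IsLowerSet (ν : Set (ℕ × ℕ))) (a : ℕ) : rowLen ν a ≤ rowLen ν 0 :=
  not_lt.1 fun hlt =>
    lt_irrefl _ ((mem_iff_lt_rowLen hν).1
      (hν (Prod.mk_le_mk.2 ⟨Nat.zero_le a, le_rfl⟩) ((mem_iff_lt_rowLen hν).2 hlt)))

set_option linter.dupNamespace false in -- deliberate Summit.<S>.<P> duplicate
/-- Column `b` of a Young diagram is nonempty iff `b` is less than the length of the top row. [folklore] -/
private theorem colLen_pos_iff (hν : IsLowerSet (ν : Set (ℕ × ℕ))) (b : ℕ) :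
    0 < colLen ν b ↔ b < rowLen ν 0 :=
  (mem_iff_lt_colLen hν).symm.trans (mem_iff_lt_rowLen hν)

set_option linter.dupNamespace false in -- deliberate Summit.<S>.<P> duplicate
/-- A "virtual corner" `(a+1, rowLen ν (a+1))` whose upper neighbour is not a cell has transition
probability `0`: the hook of `ν` at that upper neighbour vanishes, killing the column product. [folklore] -/
private theorem transProb_eq_zero_of_not_mem (hν : IsLowerSet (ν : Set (ℕ × ℕ))) {a : ℕ}
    (h : (a, rowLen ν (a + 1)) ∉ ν) : transProb ν (a + 1, rowLen ν (a + 1)) = 0 := by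
  have h1 : ¬rowLen ν (a + 1) < rowLen ν a := fun hlt => h ((mem_iff_lt_rowLen hν).2 hlt)
  have h2 : ¬a < colLen ν (rowLen ν (a + 1)) := fun hlt => h ((mem_iff_lt_colLen hν).2 hlt)
  have hhook : hook ν (a, rowLen ν (a + 1)) = 0 := by unfold hook; dsimp only; omega
  unfold transProb
  refine mul_eq_zero_of_right _ (Finset.prod_eq_zero (Finset.mem_range.2 (Nat.lt_succ_self a)) ?_)
  dsimp only
  rw [hhook, Nat.cast_zero, zero_div]

set_option linter.dupNamespace false in -- deliberate Summit.<S>.<P> duplicate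
/-- For every row `a` of a Young diagram, either `(a, rowLen ν a)` is a genuine corner
(`colLen ν (rowLen ν a) = a`) or its transition probability vanishes. [folklore] -/
private theorem colLen_rowLen_or_zero (hν : IsLowerSet (ν : Set (ℕ × ℕ))) (a : ℕ) :
    colLen ν (rowLen ν a) = a ∨ transProb ν (a, rowLen ν a) = 0 := by
  have h1 : colLen ν (rowLen ν a) ≤ a :=
    not_lt.1 fun h => lt_irrefl _ ((mem_iff_lt_rowLen hν).1 ((mem_iff_lt_colLen hν).2 h))
  rcases h1.eq_or_lt with h | h
  · exact Or.inl h
  · obtain ⟨a', rfl⟩ : ∃ a', a = a' + 1 := ⟨a - 1, by omega⟩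
    exact Or.inr (transProb_eq_zero_of_not_mem hν fun hmem => by
      have := (mem_iff_lt_colLen hν).1 hmem; omega)

set_option linter.dupNamespace false in -- deliberate Summit.<S>.<P> duplicate
/-- The sum of the transition probabilities over the addable nodes equals the sum over all rows
`a ≤ colLen ν 0` of the transition probability of the virtual corner `(a, rowLen ν a)` (the extra terms
vanish). [folklore] -/
private theorem sum_addableNodes_eq (hν : IsLowerSet (ν : Set (ℕ × ℕ))) :
    ∑ y ∈ addableNodes ν, transProb ν y =
      ∑ a ∈ Finset.range (colLen ν 0 + 1), transProb ν (a, rowLen ν a) := by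
  have hinj : ∀ a ∈ Finset.range (colLen ν 0 + 1), ∀ b ∈ Finset.range (colLen ν 0 + 1),
      (a, rowLen ν a) = (b, rowLen ν b) → a = b := fun a _ b _ h => (Prod.ext_iff.1 h).1
  rw [← Finset.sum_image hinj]
  apply Finset.sum_subset
  · rintro ⟨a, b⟩ hy
    obtain ⟨hnot, hup, hleft⟩ := Literature.RepresentationTheory.FiniteGroups.mem_addableNodes.1 hy
    dsimp only at hup hleft
    have hb : rowLen ν a = b := by
      have h1 : ¬b < rowLen ν a := fun h => hnot ((mem_iff_lt_rowLen hν).2 h)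
      rcases hleft with h0 | hmem
      · omega
      · have := (mem_iff_lt_rowLen hν).1 hmem; omega
    have ha : a < colLen ν 0 + 1 := by
      rcases hup with h0 | hmem
      · omega
      · have h0 : (a - 1, 0) ∈ ν := hν (Prod.mk_le_mk.2 ⟨le_rfl, Nat.zero_le b⟩) hmem
        have := (mem_iff_lt_colLen hν).1 h0; omega
    exact Finset.mem_image.2 ⟨a, Finset.mem_range.2 ha, by rw [hb]⟩
  · intro y hy hna
    obtain ⟨a, -, rfl⟩ := Finset.mem_image.1 hy
    rw [Literature.RepresentationTheory.FiniteGroups.mem_addableNodes] at hna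
    have hnot : (a, rowLen ν a) ∉ ν := fun h => lt_irrefl _ ((mem_iff_lt_rowLen hν).1 h)
    have hleft : rowLen ν a = 0 ∨ (a, rowLen ν a - 1) ∈ ν := by
      rcases Nat.eq_zero_or_pos (rowLen ν a) with h | h
      · exact Or.inl h
      · exact Or.inr ((mem_iff_lt_rowLen hν).2 (Nat.sub_lt h Nat.one_pos))
    have hup : ¬(a = 0 ∨ (a - 1, rowLen ν a) ∈ ν) := fun h =>
      hna (by unfold IsAddableNode; exact ⟨hnot, h, hleft⟩)
    have ha0 : a ≠ 0 := fun h0 => hup (Or.inl h0)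
    obtain ⟨a', rfl⟩ : ∃ a', a = a' + 1 := ⟨a - 1, by omega⟩
    exact transProb_eq_zero_of_not_mem hν fun h => hup (Or.inr (by simpa using h))

set_option linter.dupNamespace false in -- deliberate Summit.<S>.<P> duplicate
/-- The diagram with its top row removed is again a lower set. [folklore] -/
private theorem isLowerSet_shift (hν : IsLowerSet (ν : Set (ℕ × ℕ)))
    (hs : ∀ i j, (i, j) ∈ ν' ↔ (i + 1, j) ∈ ν) : IsLowerSet (ν' : Set (ℕ × ℕ)) := by
  rintro ⟨a1, a2⟩ ⟨b1, b2⟩ hba ha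
  rw [Finset.mem_coe, hs] at ha ⊢
  obtain ⟨h1, h2⟩ := Prod.mk_le_mk.1 hba
  exact hν (Prod.mk_le_mk.2 ⟨Nat.succ_le_succ h1, h2⟩) ha

set_option linter.dupNamespace false in -- deliberate Summit.<S>.<P> duplicate
/-- Row lengths after removing the top row. [folklore] -/
private theorem rowLen_shift (hν : IsLowerSet (ν : Set (ℕ × ℕ)))
    (hs : ∀ i j, (i, j) ∈ ν' ↔ (i + 1, j) ∈ ν) (i : ℕ) : rowLen ν' i = rowLen ν (i + 1) :=
  nat_eq_of_forall_lt_iff fun j => by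
    rw [← mem_iff_lt_rowLen (isLowerSet_shift hν hs), ← mem_iff_lt_rowLen hν]
    exact hs i j

set_option linter.dupNamespace false in -- deliberate Summit.<S>.<P> duplicate
/-- Column lengths after removing the top row drop by one (truncated). [folklore] -/
private theorem colLen_shift (hν : IsLowerSet (ν : Set (ℕ × ℕ)))
    (hs : ∀ i j, (i, j) ∈ ν' ↔ (i + 1, j) ∈ ν) (j : ℕ) : colLen ν' j = colLen ν j - 1 :=
  nat_eq_of_forall_lt_iff fun i => by
    rw [← mem_iff_lt_colLen (isLowerSet_shift hν hs), hs, mem_iff_lt_colLen hν]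
    omega

set_option linter.dupNamespace false in -- deliberate Summit.<S>.<P> duplicate
/-- Hooks below the top row are the hooks of the diagram with the top row removed. [folklore] -/
private theorem hook_shift (hν : IsLowerSet (ν : Set (ℕ × ℕ)))
    (hs : ∀ i j, (i, j) ∈ ν' ↔ (i + 1, j) ∈ ν) (a j : ℕ) : hook ν (a + 1, j) = hook ν' (a, j) := by
  unfold hook; dsimp only
  rw [rowLen_shift hν hs, colLen_shift hν hs]
  omega

set_option linter.dupNamespace false in -- deliberate Summit.<S>.<P> duplicate
/-- Transition probabilities below the top row: `p^ν_(a+1, b) = h(0,b)/(h(0,b)+1) · p^{ν'}_(a, b)`.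
[folklore] -/
private theorem transProb_shift (hν : IsLowerSet (ν : Set (ℕ × ℕ)))
    (hs : ∀ i j, (i, j) ∈ ν' ↔ (i + 1, j) ∈ ν) (a b : ℕ) :
    transProb ν (a + 1, b) = (hook ν (0, b) : ℝ) / (hook ν (0, b) + 1) * transProb ν' (a, b) := by
  unfold transProb; dsimp only
  rw [Finset.prod_range_succ' (fun i => (hook ν (i, b) : ℝ) / (hook ν (i, b) + 1)) a]
  simp_rw [hook_shift hν hs]
  ring

set_option linter.dupNamespace false in -- deliberate Summit.<S>.<P> duplicate
/-- The top-row hooks in Kerov form: `h(0, b) = n - b + colLen ν' b` for `b ≤ n = rowLen ν 0` (at `b = n`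
both sides vanish). [folklore] -/
private theorem hook_zero_cast (hν : IsLowerSet (ν : Set (ℕ × ℕ)))
    (hs : ∀ i j, (i, j) ∈ ν' ↔ (i + 1, j) ∈ ν) {b : ℕ} (hb : b ≤ rowLen ν 0) :
    (hook ν (0, b) : ℝ) = rowLen ν 0 - b + colLen ν' b := by
  have key := colLen_pos_iff hν b
  have h : hook ν (0, b) + b = rowLen ν 0 + colLen ν' b := by
    rw [colLen_shift hν hs]; unfold hook; dsimp only; omega
  have h' := congrArg (Nat.cast : ℕ → ℝ) h
  push_cast at h'
  linarith

set_option linter.dupNamespace false in -- deliberate Summit.<S>.<P> duplicate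
/-- The top corner: `p_(0, n) = R_n(ν', n + 1)` with Kerov's
`R_N(ν, u) = (u - N)⁻¹ ∏_{j<N} (u - j + colLen ν j - 1)/(u - j + colLen ν j)`. [folklore] -/
private theorem transProb_zero (hν : IsLowerSet (ν : Set (ℕ × ℕ)))
    (hs : ∀ i j, (i, j) ∈ ν' ↔ (i + 1, j) ∈ ν) :
    transProb ν (0, rowLen ν 0) =
      ((rowLen ν 0 : ℝ) + 1 - (rowLen ν 0 : ℝ))⁻¹ *
        ∏ j ∈ Finset.range (rowLen ν 0),
          (((rowLen ν 0 : ℝ) + 1 - j + colLen ν' j - 1) / ((rowLen ν 0 : ℝ) + 1 - j + colLen ν' j)) := by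
  unfold transProb; dsimp only
  rw [Finset.prod_range_zero, mul_one, add_sub_cancel_left, inv_one, one_mul]
  refine Finset.prod_congr rfl fun j hj => ?_
  rw [hook_zero_cast hν hs (Finset.mem_range.1 hj).le]
  ring

set_option linter.dupNamespace false in -- deliberate Summit.<S>.<P> duplicate
/-- Removing the top row shifts the generating function: `R_n(ν, u) = (u - n + 1)/(u - n) · R_n(ν', u + 1)`.
[folklore] -/
private theorem kerovR_shift (hν : IsLowerSet (ν : Set (ℕ × ℕ)))
    (hs : ∀ i j, (i, j) ∈ ν' ↔ (i + 1, j) ∈ ν) {u : ℝ} (hu : (rowLen ν 0 : ℝ) < u) :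
    (u - (rowLen ν 0 : ℝ))⁻¹ *
        ∏ j ∈ Finset.range (rowLen ν 0), ((u - j + colLen ν j - 1) / (u - j + colLen ν j)) =
      (u - rowLen ν 0 + 1) / (u - rowLen ν 0) *
        ((u + 1 - (rowLen ν 0 : ℝ))⁻¹ *
          ∏ j ∈ Finset.range (rowLen ν 0),
            ((u + 1 - j + colLen ν' j - 1) / (u + 1 - j + colLen ν' j))) := by
  have hprod : ∏ j ∈ Finset.range (rowLen ν 0), ((u - j + colLen ν j - 1) / (u - j + colLen ν j)) =
      ∏ j ∈ Finset.range (rowLen ν 0), ((u + 1 - j + colLen ν' j - 1) / (u + 1 - j + colLen ν' j)) := by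
    refine Finset.prod_congr rfl fun j hj => ?_
    have hc : colLen ν j = colLen ν' j + 1 := by
      have h1 := (colLen_pos_iff hν j).2 (Finset.mem_range.1 hj)
      have h2 := colLen_shift hν hs j
      omega
    rw [hc]; push_cast; ring
  rw [hprod]
  have h1 : u - (rowLen ν 0 : ℝ) ≠ 0 := ne_of_gt (sub_pos.2 hu)
  have h2 : u + 1 - (rowLen ν 0 : ℝ) ≠ 0 := ne_of_gt (by linarith)
  field_simp
  ring

set_option linter.dupNamespace false in -- deliberate Summit.<S>.<P> duplicate
/-- One telescoping step: `(A - 1)⁻¹ · P · (A - 1)/A = A⁻¹ · P`. [folklore] -/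
private theorem inv_mul_mul_div_aux {A P : ℝ} (hA : A - 1 ≠ 0) :
    (A - 1)⁻¹ * (P * ((A - 1) / A)) = A⁻¹ * P := by
  rw [div_eq_mul_inv, mul_comm P, ← mul_assoc, ← mul_assoc, inv_mul_cancel₀ hA, one_mul]

set_option linter.dupNamespace false in -- deliberate Summit.<S>.<P> duplicate
/-- `R_N(ν, u)` does not depend on `N ≥ n` (the extra factors telescope against `(u - N)⁻¹`). [folklore] -/
private theorem kerovR_add (hν : IsLowerSet (ν : Set (ℕ × ℕ))) (k : ℕ) {u : ℝ}
    (hu : (rowLen ν 0 : ℝ) + k < u) :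
    (u - ((rowLen ν 0 + k : ℕ) : ℝ))⁻¹ *
        ∏ j ∈ Finset.range (rowLen ν 0 + k), ((u - j + colLen ν j - 1) / (u - j + colLen ν j)) =
      (u - (rowLen ν 0 : ℝ))⁻¹ *
        ∏ j ∈ Finset.range (rowLen ν 0), ((u - j + colLen ν j - 1) / (u - j + colLen ν j)) := by
  induction k with
  | zero => simp
  | succ k ih =>
    have hu' : (rowLen ν 0 : ℝ) + k < u := by push_cast at hu; linarith
    rw [← ih hu']
    have hcol : colLen ν (rowLen ν 0 + k) = 0 := by
      have := colLen_pos_iff hν (rowLen ν 0 + k); omega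
    rw [← Nat.add_assoc, Finset.prod_range_succ, hcol, Nat.cast_zero, add_zero,
      show (u - ((rowLen ν 0 + k + 1 : ℕ) : ℝ)) = u - ((rowLen ν 0 + k : ℕ) : ℝ) - 1 by push_cast; ring]
    exact inv_mul_mul_div_aux (by push_cast at hu ⊢; exact ne_of_gt (by linarith))

set_option linter.dupNamespace false in -- deliberate Summit.<S>.<P> duplicate
/-- **Main induction** (on the number of rows `L = colLen ν 0`): the row sums of the transition
probabilities equal `1`, and their Cauchy transform is Kerov's `R_n(ν, u)` for `u > n`. [folklore] -/
private theorem main (L : ℕ) : ∀ ν : Finset (ℕ × ℕ), IsLowerSet (ν : Set (ℕ × ℕ)) → colLen ν 0 = L →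
    (∑ a ∈ Finset.range (L + 1), transProb ν (a, rowLen ν a)) = 1 ∧
      ∀ u : ℝ, (rowLen ν 0 : ℝ) < u →
        ∑ a ∈ Finset.range (L + 1), transProb ν (a, rowLen ν a) / (u - ((rowLen ν a : ℝ) - a)) =
          (u - (rowLen ν 0 : ℝ))⁻¹ *
            ∏ j ∈ Finset.range (rowLen ν 0), ((u - j + colLen ν j - 1) / (u - j + colLen ν j)) := by
  induction L with
  | zero =>
    intro ν hν hL
    have hrow : rowLen ν 0 = 0 := by
      have := colLen_pos_iff hν 0; omega
    exact ⟨by simp [hrow, transProb], fun u _ => by simp [hrow, transProb]⟩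
  | succ L ih =>
    intro ν hν hL
    obtain ⟨ν', hs⟩ : ∃ ν' : Finset (ℕ × ℕ), ∀ i j, (i, j) ∈ ν' ↔ (i + 1, j) ∈ ν :=
      ⟨ν.preimage (fun c => (c.1 + 1, c.2)) fun a _ b _ h => by
          have h' : (a.1 + 1, a.2) = (b.1 + 1, b.2) := h
          simp only [Prod.mk.injEq] at h'
          exact Prod.ext (by omega) h'.2,
        fun i j => Finset.mem_preimage⟩
    have hν' := isLowerSet_shift hν hs
    have hL' : colLen ν' 0 = L := by rw [colLen_shift hν hs, hL, Nat.add_sub_cancel]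
    obtain ⟨ih1, ih2⟩ := ih ν' hν' hL'
    have hrow' : ∀ a, rowLen ν' a ≤ rowLen ν 0 := fun a => by
      rw [rowLen_shift hν hs]; exact rowLen_le hν (a + 1)
    have hn' : (rowLen ν' 0 : ℝ) < (rowLen ν 0 : ℝ) + 1 := by
      exact_mod_cast Nat.lt_succ_of_le (hrow' 0)
    have hindep : ∀ w : ℝ, (rowLen ν 0 : ℝ) < w →
        (w - (rowLen ν' 0 : ℝ))⁻¹ *
            ∏ j ∈ Finset.range (rowLen ν' 0), ((w - j + colLen ν' j - 1) / (w - j + colLen ν' j)) =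
          (w - (rowLen ν 0 : ℝ))⁻¹ *
            ∏ j ∈ Finset.range (rowLen ν 0), ((w - j + colLen ν' j - 1) / (w - j + colLen ν' j)) := by
      intro w hw
      obtain ⟨k, hk⟩ : ∃ k, rowLen ν 0 = rowLen ν' 0 + k := ⟨_, (Nat.add_sub_of_le (hrow' 0)).symm⟩
      have hw' : (rowLen ν' 0 : ℝ) + k < w := by rw [hk] at hw; exact_mod_cast hw
      rw [hk]
      exact (kerovR_add hν' k hw').symm
    have hpt : ∀ a ∈ Finset.range (L + 1), transProb ν (a + 1, rowLen ν (a + 1)) =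
        transProb ν' (a, rowLen ν' a) -
          transProb ν' (a, rowLen ν' a) / ((rowLen ν 0 : ℝ) + 1 - ((rowLen ν' a : ℝ) - a)) := by
      intro a _
      rw [transProb_shift hν hs, ← rowLen_shift hν hs a, hook_zero_cast hν hs (hrow' a)]
      rcases colLen_rowLen_or_zero hν' a with hcol | hzero
      · rw [hcol]
        have hle : (rowLen ν' a : ℝ) ≤ rowLen ν 0 := by exact_mod_cast hrow' a
        have ha0 : (0 : ℝ) ≤ a := Nat.cast_nonneg a
        have h1 : (rowLen ν 0 : ℝ) - rowLen ν' a + a + 1 ≠ 0 := ne_of_gt (by linarith)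
        have h2 : (rowLen ν 0 : ℝ) + 1 - ((rowLen ν' a : ℝ) - a) ≠ 0 := ne_of_gt (by linarith)
        field_simp
        ring
      · rw [hzero]; simp
    refine ⟨?_, fun u hu => ?_⟩
    · rw [Finset.sum_range_succ', Finset.sum_congr rfl hpt, Finset.sum_sub_distrib, ih1,
        ih2 ((rowLen ν 0 : ℝ) + 1) hn', hindep ((rowLen ν 0 : ℝ) + 1) (by linarith),
        transProb_zero hν hs]
      ring
    · have hpt2 : ∀ a ∈ Finset.range (L + 1),
          transProb ν (a + 1, rowLen ν (a + 1)) / (u - ((rowLen ν (a + 1) : ℝ) - ((a + 1 : ℕ) : ℝ))) =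
            (u - rowLen ν 0 + 1) / (u - rowLen ν 0) *
                (transProb ν' (a, rowLen ν' a) / (u + 1 - ((rowLen ν' a : ℝ) - a))) -
              (u - (rowLen ν 0 : ℝ))⁻¹ *
                (transProb ν' (a, rowLen ν' a) /
                  ((rowLen ν 0 : ℝ) + 1 - ((rowLen ν' a : ℝ) - a))) := by
        intro a ha
        rw [hpt a ha, ← rowLen_shift hν hs a]
        have hle : (rowLen ν' a : ℝ) ≤ rowLen ν 0 := by exact_mod_cast hrow' a
        have ha0 : (0 : ℝ) ≤ a := Nat.cast_nonneg a
        have h1 : u - (rowLen ν 0 : ℝ) ≠ 0 := ne_of_gt (by linarith)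
        have h2 : (rowLen ν 0 : ℝ) + 1 - ((rowLen ν' a : ℝ) - a) ≠ 0 := ne_of_gt (by linarith)
        have h3 : u + 1 - ((rowLen ν' a : ℝ) - a) ≠ 0 := ne_of_gt (by linarith)
        have h4 : u - ((rowLen ν' a : ℝ) - ((a : ℝ) + 1)) ≠ 0 := ne_of_gt (by linarith)
        push_cast
        field_simp
        ring
      rw [Finset.sum_range_succ', Finset.sum_congr rfl hpt2, Finset.sum_sub_distrib, ← Finset.mul_sum,
        ← Finset.mul_sum, ih2 (u + 1) (by linarith), ih2 ((rowLen ν 0 : ℝ) + 1) hn',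
        hindep (u + 1) (by linarith), hindep ((rowLen ν 0 : ℝ) + 1) (by linarith),
        transProb_zero hν hs, kerovR_shift hν hs hu]
      push_cast
      ring

set_option linter.dupNamespace false in -- deliberate Summit.<S>.<P> duplicate
/-- **Greene–Nijenhuis–Wilf / Kerov: the Plancherel transition probabilities of a Young diagram sum to
one.** For a finite lower set `ν ⊆ ℕ × ℕ`, `Σ_{y addable} p_y = 1` with
`p_y = ∏_{j < col y} h(row y, j)/(h+1) · ∏_{i < row y} h(i, col y)/(h+1)` the hook-product transition
probability (`= f^{ν ∪ y}/((|ν|+1) f^ν)`): Greene–Nijenhuis–Wilf, Adv. Math. 31 (1979) 104–109, §2 (the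
hook walk ends at a corner with exactly these probabilities), here proved in Kerov's generating-function
form by induction on the number of rows (`main`). [cite: GreeneNijenhuisWilf1979, §2] -/
theorem transProb_sum_eq_one : ∀ (ν : Finset (ℕ × ℕ)), IsLowerSet (ν : Set (ℕ × ℕ)) →
    ∑ y ∈ addableNodes ν, transProb ν y = 1 := by
  intro ν hν
  rw [sum_addableNodes_eq hν]
  exact (main (colLen ν 0) ν hν rfl).1

end Summit.MatrixMultiplication.MatrixMultiplication.Theorems
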